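import Summits.KontsevichZagierPeriods.KontsevichZagierPeriods.Theorems.SoloInformedMobiusRadical
import HarnessLib
import HarnessLib.Audit

/-!
# SoloInformed — separable bands in dimension 2 as ONE Newton–Leibniz move

Solo programme `solo-KontsevichZagierPeriods-informed`, session s112, file 37.

Rule (3) (Newton–Leibniz along the last coordinate) turns a two-dimensional representation over a
polynomial band with separable `K`-rational × polynomial-derivative integrand into a one-dimensional
`K`-rational representation, in one move:
`[{(x, y) : x ∈ D, A(x) ≤ y ≤ B(x)}, f(x)·G'(y)] − [D, f(x)·(G(B(x)) − G(A(x)))] ∈ relations`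
(`f = P_f/Q_f`, `A, B, G ∈ K[X]`; primitive `F(x, y) = f(x) G(y)`).  In particular Fubini for
cylinders `D × [p, q]` with separable integrands is a consequence of the three KZ rules, and THEOREM
`soloInformed_kzp_cylinderNL`: every such absolutely convergent two-dimensional integral satisfies
the period conjecture against the one-variable elementary(-sum) class, the Chebyshev–Euler class,
rational representations of dimension `≤ 1`, and the span of points and segments.  Unconditional.
(Beyond this — e.g. `G'(y) = 1/(1+y)` — the boundary term is a logarithm and the values are
dilogarithms: outside the weight-one theory, cf. the scope statement of file 21.)

References: M. Kontsevich, D. Zagier, *Periods* (2001), §1.2 rule (3); this work.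
-/

noncomputable section

open scoped BigOperators Polynomial

namespace Summit.KontsevichZagierPeriods.KontsevichZagierPeriods.Theorems

open Set MeasureTheory
open Literature.ModelTheory.ExponentialFields
open Literature.NumberTheory.Transcendental Literature.NumberTheory.Transcendental.KZ

/-- **The separable band move.** With `f = P_f/Q_f` (`Q_f ≠ 0` on `D`), `A ≤ B` on `D`, `G ∈ K[X]`:
`[band, f(x) G'(y)] − [D, f(x)(G(B x) − G(A x))]` is a relation (one move of rule (3), primitive
`F = f(x) G(y)`). [Kontsevich–Zagier 2001, §1.2 rule (3)] -/
theorem soloInformed_cylinderNL_mem_relations (r : IntegralRep 2) (r₁ : IntegralRep 1)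
    (A B G Pf Qf : (algebraicClosure ℚ ℝ)[X])
    (hAB : ∀ x ∈ r₁.domain, (Polynomial.aeval (x 0) A : ℝ) ≤ Polynomial.aeval (x 0) B)
    (hQf : ∀ x ∈ r₁.domain, (Polynomial.aeval (x 0) Qf : ℝ) ≠ 0)
    (hdom : r.domain = {z | (Fin.init z : Fin 1 → ℝ) ∈ r₁.domain ∧
      (Polynomial.aeval (Fin.init z 0) A : ℝ) ≤ z (Fin.last 1) ∧
      z (Fin.last 1) ≤ Polynomial.aeval (Fin.init z 0) B})
    (hf : ∀ z ∈ r.domain, r.integrand z = (Polynomial.aeval (z 0) Pf : ℝ) / Polynomial.aeval (z 0) Qf *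
      Polynomial.aeval (z (Fin.last 1)) (Polynomial.derivative G))
    (hf₁ : ∀ x ∈ r₁.domain, r₁.integrand x = (Polynomial.aeval (x 0) Pf : ℝ) / Polynomial.aeval (x 0) Qf *
      (Polynomial.aeval (Polynomial.aeval (x 0) B : ℝ) G - Polynomial.aeval (Polynomial.aeval (x 0) A : ℝ) G)) :
    of r - of r₁ ∈ relations := by
  have hK := soloInformed_isAlgebraic_algebraMap_K
  -- coordinates of `Fin.snoc x t`, and univariate polynomials read in one coordinate
  have soloInformed_snoc_two : ∀ (x : Fin 1 → ℝ) (t : ℝ),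
      (Fin.snoc x t : Fin 2 → ℝ) 0 = x 0 ∧ (Fin.snoc x t : Fin 2 → ℝ) (Fin.last 1) = t := fun x t =>
    ⟨Fin.snoc_castSucc (α := fun _ : Fin 2 => ℝ) (p := x) (x := t) (i := 0),
      Fin.snoc_last (α := fun _ : Fin 2 => ℝ) (x := t) (p := x)⟩
  have soloInformed_aeval_aeval_X : ∀ {n : ℕ} (P : (algebraicClosure ℚ ℝ)[X]) (i : Fin n)
      (z : Fin n → ℝ), (MvPolynomial.aeval z (Polynomial.aeval (MvPolynomial.X i :
        MvPolynomial (Fin n) (algebraicClosure ℚ ℝ)) P) : ℝ) = Polynomial.aeval (z i) P :=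
    fun P i z => by rw [← Polynomial.aeval_algHom_apply, MvPolynomial.aeval_X]
  set F : (Fin 2 → ℝ) → ℝ := fun z => (Polynomial.aeval (z 0) Pf : ℝ) / Polynomial.aeval (z 0) Qf *
    Polynomial.aeval (z (Fin.last 1)) G with hFdef
  set a : (Fin 1 → ℝ) → ℝ := fun x => Polynomial.aeval (x 0) A with hadef
  set b : (Fin 1 → ℝ) → ℝ := fun x => Polynomial.aeval (x 0) B with hbdef
  have hinit0 : ∀ z : Fin 2 → ℝ, Fin.init z 0 = z 0 := fun z => rfl
  have hFsnoc : ∀ (x : Fin 1 → ℝ) (t : ℝ), F (Fin.snoc x t) =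
      (Polynomial.aeval (x 0) Pf : ℝ) / Polynomial.aeval (x 0) Qf * Polynomial.aeval t G := fun x t => by
    rw [hFdef]
    show (Polynomial.aeval ((Fin.snoc x t : Fin 2 → ℝ) 0) Pf : ℝ) /
        Polynomial.aeval ((Fin.snoc x t : Fin 2 → ℝ) 0) Qf *
        Polynomial.aeval ((Fin.snoc x t : Fin 2 → ℝ) (Fin.last 1)) G = _
    rw [(soloInformed_snoc_two x t).1, (soloInformed_snoc_two x t).2]
  have hmem : ∀ x ∈ r₁.domain, ∀ t, a x ≤ t → t ≤ b x → (Fin.snoc x t : Fin 2 → ℝ) ∈ r.domain :=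
    fun x hx t h1 h2 => by
    rw [hdom]
    refine ⟨?_, ?_, ?_⟩
    · rw [Fin.init_snoc]; exact hx
    · rw [Fin.init_snoc, (soloInformed_snoc_two x t).2]; exact h1
    · rw [Fin.init_snoc, (soloInformed_snoc_two x t).2]; exact h2
  -- semialgebraicity of the primitive and of the bounds
  have hF : IsSemialgebraicFunOn ℚ r.domain F := by
    have hQ : ∀ z ∈ r.domain, (MvPolynomial.aeval z (Polynomial.aeval (MvPolynomial.X 0 :
        MvPolynomial (Fin 2) (algebraicClosure ℚ ℝ)) Qf) : ℝ) ≠ 0 := fun z hz => by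
      rw [soloInformed_aeval_aeval_X]
      rw [hdom] at hz
      exact hQf _ hz.1
    refine (soloInformed_isSemialgebraicFunOn_aevalK_div hK r.isSemialgebraic_domain
      (Polynomial.aeval (MvPolynomial.X 0 : MvPolynomial (Fin 2) (algebraicClosure ℚ ℝ)) Pf *
        Polynomial.aeval (MvPolynomial.X (Fin.last 1) : MvPolynomial (Fin 2) (algebraicClosure ℚ ℝ)) G)
      (Polynomial.aeval (MvPolynomial.X 0 : MvPolynomial (Fin 2) (algebraicClosure ℚ ℝ)) Qf) hQ).congr
      fun z _ => ?_
    simp only [map_mul, soloInformed_aeval_aeval_X, hFdef]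
    ring
  have ha : IsSemialgebraicFunOn ℚ r₁.domain a :=
    (soloInformed_isSemialgebraicFunOn_aevalK hK r₁.isSemialgebraic_domain
      (Polynomial.aeval (MvPolynomial.X 0 : MvPolynomial (Fin 1) (algebraicClosure ℚ ℝ)) A)).congr
      fun x _ => by simp only [soloInformed_aeval_aeval_X, hadef]
  have hb : IsSemialgebraicFunOn ℚ r₁.domain b :=
    (soloInformed_isSemialgebraicFunOn_aevalK hK r₁.isSemialgebraic_domain
      (Polynomial.aeval (MvPolynomial.X 0 : MvPolynomial (Fin 1) (algebraicClosure ℚ ℝ)) B)).congr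
      fun x _ => by simp only [soloInformed_aeval_aeval_X, hbdef]
  refine newtonLeibnizRel_subset_relations ⟨1, r, r₁, a, b, F, hF, ha, hb, hAB, ?_, ?_, ?_, ?_, rfl⟩
  · rw [hdom]
  · intro x hx
    have hc : Continuous fun t : ℝ => (Polynomial.aeval (x 0) Pf : ℝ) / Polynomial.aeval (x 0) Qf *
        Polynomial.aeval t G := continuous_const.mul (Polynomial.continuous_aeval G)
    exact hc.continuousOn.congr fun t _ => hFsnoc x t
  · intro x hx t ht
    have hfun : (fun s : ℝ => F (Fin.snoc x s)) = fun s => (Polynomial.aeval (x 0) Pf : ℝ) /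
        Polynomial.aeval (x 0) Qf * Polynomial.aeval s G := funext fun s => hFsnoc x s
    rw [hfun, hf _ (hmem x hx t ht.1.le ht.2.le), (soloInformed_snoc_two x t).1,
      (soloInformed_snoc_two x t).2]
    exact (Polynomial.hasDerivAt_aeval G t).const_mul _
  · intro x hx
    rw [hf₁ x hx, hFsnoc, hFsnoc]
    ring

/-- **Separable bands lie in the span of points and segments.** -/
theorem soloInformed_segSpan_of_cylinderNL (r : IntegralRep 2) (r₁ : IntegralRep 1)
    (A B G Pf Qf : (algebraicClosure ℚ ℝ)[X])
    (hAB : ∀ x ∈ r₁.domain, (Polynomial.aeval (x 0) A : ℝ) ≤ Polynomial.aeval (x 0) B)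
    (hQf : ∀ x ∈ r₁.domain, (Polynomial.aeval (x 0) Qf : ℝ) ≠ 0)
    (hdom : r.domain = {z | (Fin.init z : Fin 1 → ℝ) ∈ r₁.domain ∧
      (Polynomial.aeval (Fin.init z 0) A : ℝ) ≤ z (Fin.last 1) ∧
      z (Fin.last 1) ≤ Polynomial.aeval (Fin.init z 0) B})
    (hf : ∀ z ∈ r.domain, r.integrand z = (Polynomial.aeval (z 0) Pf : ℝ) / Polynomial.aeval (z 0) Qf *
      Polynomial.aeval (z (Fin.last 1)) (Polynomial.derivative G))
    (hf₁ : ∀ x ∈ r₁.domain, r₁.integrand x = (Polynomial.aeval (x 0) Pf : ℝ) / Polynomial.aeval (x 0) Qf *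
      (Polynomial.aeval (Polynomial.aeval (x 0) B : ℝ) G - Polynomial.aeval (Polynomial.aeval (x 0) A : ℝ) G)) :
    of r₁ ∈ soloInformedSegSpan ∧ of r ∈ soloInformedSegSpan := by
  have h₁ : of r₁ ∈ soloInformedSegSpan :=
    soloInformed_segSpan_of_isKRationalOne r₁ ⟨Pf * (G.comp B - G.comp A), Qf, hQf, fun x hx => by
      show r₁.integrand x = (Polynomial.aeval (x 0) (Pf * (G.comp B - G.comp A)) : ℝ) /
        Polynomial.aeval (x 0) Qf
      rw [hf₁ x hx, map_mul, map_sub, Polynomial.aeval_comp, Polynomial.aeval_comp]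
      ring⟩
  exact ⟨h₁, soloInformed_mem_segSpan_of_sub_mem
    (soloInformed_cylinderNL_mem_relations r r₁ A B G Pf Qf hAB hQf hdom hf hf₁) h₁⟩

/-- **The period conjecture for separable two-dimensional bands.**  For `r = [band, f(x) G'(y)]`
as above (with its base representation `r₁`): `Equivalent r r₁`; and `r` is KZ-equivalent to every
elementary sum, every member of the Chebyshev–Euler class, every rational representation of
dimension `≤ 1` and every member of the span of points and segments with the same value.
Unconditional. [Kontsevich–Zagier 2001, §1.2; this work] -/
theorem soloInformed_kzp_cylinderNL (r : IntegralRep 2) (r₁ : IntegralRep 1)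
    (A B G Pf Qf : (algebraicClosure ℚ ℝ)[X])
    (hAB : ∀ x ∈ r₁.domain, (Polynomial.aeval (x 0) A : ℝ) ≤ Polynomial.aeval (x 0) B)
    (hQf : ∀ x ∈ r₁.domain, (Polynomial.aeval (x 0) Qf : ℝ) ≠ 0)
    (hdom : r.domain = {z | (Fin.init z : Fin 1 → ℝ) ∈ r₁.domain ∧
      (Polynomial.aeval (Fin.init z 0) A : ℝ) ≤ z (Fin.last 1) ∧
      z (Fin.last 1) ≤ Polynomial.aeval (Fin.init z 0) B})
    (hf : ∀ z ∈ r.domain, r.integrand z = (Polynomial.aeval (z 0) Pf : ℝ) / Polynomial.aeval (z 0) Qf *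
      Polynomial.aeval (z (Fin.last 1)) (Polynomial.derivative G))
    (hf₁ : ∀ x ∈ r₁.domain, r₁.integrand x = (Polynomial.aeval (x 0) Pf : ℝ) / Polynomial.aeval (x 0) Qf *
      (Polynomial.aeval (Polynomial.aeval (x 0) B : ℝ) G - Polynomial.aeval (Polynomial.aeval (x 0) A : ℝ) G)) :
    Equivalent r r₁ ∧
    (∀ r₂ : IntegralRep 1, SoloInformedIsKElementarySumOne r₂ → r.value = r₂.value → Equivalent r r₂) ∧
    (∀ {m : ℕ} (hm : m ≠ 0) (r₂ : IntegralRep 1), SoloInformedIsKMobiusRadicalOne m r₂ →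
      r.value = r₂.value → Equivalent r r₂) ∧
    (∀ {n : ℕ} (hn : n ≤ 1) (r₀ : IntegralRep n), r₀.IsRational → r.value = r₀.value →
      Equivalent r r₀) ∧
    (∀ {k : ℕ} (r₂ : IntegralRep k), of r₂ ∈ soloInformedSegSpan → r.value = r₂.value →
      Equivalent r r₂) := by
  obtain ⟨h₁, h⟩ := soloInformed_segSpan_of_cylinderNL r r₁ A B G Pf Qf hAB hQf hdom hf hf₁
  have hrel := soloInformed_cylinderNL_mem_relations r r₁ A B G Pf Qf hAB hQf hdom hf hf₁
  refine ⟨?_, fun r₂ hr₂ hv => soloInformed_equivalent_of_mem_segSpan h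
      (soloInformed_segSpan_of_isKElementarySumOne r₂ hr₂) hv,
    fun hm r₂ hr₂ hv => soloInformed_equivalent_of_mem_segSpan h
      (soloInformed_segSpan_of_isKMobiusRadicalOne hm r₂ hr₂) hv,
    fun hn r₀ hr₀ hv => soloInformed_equivalent_of_mem_segSpan h
      (soloInformed_of_mem_segSpan_of_isRational hn r₀ hr₀) hv,
    fun r₂ hr₂ hv => soloInformed_equivalent_of_mem_segSpan h hr₂ hv⟩
  have hv : r.value = r₁.value := by
    have h0 : eval (of r - of r₁) = 0 := relations_le_ker_eval_holds hrel
    rw [map_sub, eval_of, eval_of] at h0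
    exact sub_eq_zero.1 h0
  exact soloInformed_equivalent_of_mem_segSpan h h₁ hv

end Summit.KontsevichZagierPeriods.KontsevichZagierPeriods.Theorems
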